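import Literature.AlgebraicGeometry.Shioda1982.ExceptionalQuadruplesComplete
import HarnessLib

/-!
# Shioda 1982 / Meyer–Neutsch 1981: no exceptional quadruple at the level `N = 486` — kernel sweep, part 1 of 12

Topic `Literature/AlgebraicGeometry/Shioda1982`; companion of `ExceptionalQuadruplesComplete.lean` (search `checkB`, soundness
`tabelleOneCompleteAt_of_chunks`, invariant form `exists_mem_reps_of_isExceptionalQuadruple`, statement `TabelleOneCompleteAt`; sources,
method and framing in its module docstring) and of the series `ExceptionalQuadruplesSweep*.lean` (together: every level `2 ≤ N ≤ 180`
that is not a row of Tabelle 1; `…SweepTwoHundredTwenty/…TwoHundredSixty/…ThreeHundredForty.lean`,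
`…SweepTwoHundredFiftyTwo/…ThreeHundredNinetySix/…FourHundredSixtyEight.lean`, `…SweepTwoHundred.lean`: the levels `220, 260, 340`, `252, 396, 468`
and `200` of the families `20p`, `36p`, `40p`; `…Sweep<Level>[Part<K>].lean` for the `{2,3,5,7}`-smooth residual levels
`189, 192, 210, 216, 224, 240, 270, 288, 300, 315, 320, 324, 336, 360, 378, 384, 405, 420, 432, 448` and now `480 … 630`). THEOREMS only (no definition, no named fact): the same kernel
search at the single level `N = 486`, which carries NO row of [MeyerNeutsch1981Fermatquadrupel, Tabelle 1] (computer-generated there,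
"alle Fermatquadrupel für N ≤ 614 ermittelt", §2 p. 53) and lies above the range `N ≤ 180` of Shioda's table p. 727 — by Aoki's
Theorem C ([Aoki1983], computer-assisted for `181 ≤ m ≤ 672`) there is no exceptional element at any level `> 180`; the files
`ExceptionalQuadruplesSweepFourHundredEightySixPartOne.lean`, `ExceptionalQuadruplesSweepFourHundredEightySixPartTwo.lean`, `ExceptionalQuadruplesSweepFourHundredEightySixPartThree.lean`, `ExceptionalQuadruplesSweepFourHundredEightySixPartFour.lean`, `ExceptionalQuadruplesSweepFourHundredEightySixPartFive.lean`, `ExceptionalQuadruplesSweepFourHundredEightySixPartSix.lean`, `ExceptionalQuadruplesSweepFourHundredEightySixPartSeven.lean`, `ExceptionalQuadruplesSweepFourHundredEightySixPartEight.lean`, `ExceptionalQuadruplesSweepFourHundredEightySixPartNine.lean`, `ExceptionalQuadruplesSweepFourHundredEightySixPartTen.lean`, `ExceptionalQuadruplesSweepFourHundredEightySixPartEleven.lean`, `ExceptionalQuadruplesSweepFourHundredEightySix.lean` make the instance `N = 486` a kernel statement. The search at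
`N = 486` visits 3218211 candidate triples (`φ(486) − 1 = 161` units each), too many for one elaboration of bounded wall time, so the
chunks of first entries are spread over 12 files: `ExceptionalQuadruplesSweepFourHundredEightySixPartOne.lean` — first entries `0 ≤ a < 13` (261678 candidates);
`ExceptionalQuadruplesSweepFourHundredEightySixPartTwo.lean` — first entries `13 ≤ a < 26` (271663 candidates);
`ExceptionalQuadruplesSweepFourHundredEightySixPartThree.lean` — first entries `26 ≤ a < 38` (256145 candidates);
`ExceptionalQuadruplesSweepFourHundredEightySixPartFour.lean` — first entries `38 ≤ a < 51` (279544 candidates);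
`ExceptionalQuadruplesSweepFourHundredEightySixPartFive.lean` — first entries `51 ≤ a < 63` (256545 candidates);
`ExceptionalQuadruplesSweepFourHundredEightySixPartSix.lean` — first entries `63 ≤ a < 76` (272530 candidates);
`ExceptionalQuadruplesSweepFourHundredEightySixPartSeven.lean` — first entries `76 ≤ a < 89` (262995 candidates);
`ExceptionalQuadruplesSweepFourHundredEightySixPartEight.lean` — first entries `89 ≤ a < 103` (267943 candidates);
`ExceptionalQuadruplesSweepFourHundredEightySixPartNine.lean` — first entries `103 ≤ a < 119` (280507 candidates);
`ExceptionalQuadruplesSweepFourHundredEightySixPartTen.lean` — first entries `119 ≤ a < 136` (259930 candidates);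
`ExceptionalQuadruplesSweepFourHundredEightySixPartEleven.lean` — first entries `136 ≤ a < 159` (273431 candidates);
`ExceptionalQuadruplesSweepFourHundredEightySix.lean` — first entries `159 ≤ a < 486` (275300 candidates); the last one assembles
`completeAt_fourHundredEightySix` (every sorted pair-free primitive Hodge 4-multiset mod `486` is standard) and `not_isExceptionalQuadruple_fourHundredEightySix`.
WHY THIS LEVEL (cell `pub-hfermat`): `486 = 2·3⁵`: the tree's character-sum families cover the levels `K·p`, `p` a prime above a bound depending on `K`, for
`K ∈ {2, 3, 4, 6, 8, 9, 10, 12, 18, 20, 24, 36, 40}` or `K` a power of `2` or of `3` (`PicardNumber<K>Prime.lean`, `PicardNumberTwoPowerPrime.lean`,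
`PicardNumberThreePowPrime.lean`) and the prime-power levels (`PicardNumberPrimePower.lean`); writing `486 = K·p` with `p` prime forces
`K ∈ {162, 243}`; `K = 243 = 3⁵` with `p = 2` is below the range `p ≥ 11` of `exceptional_threePowPrime`, the other is not among those `K`. `decide +kernel` only (no `native_decide`).

HONEST FRAMING (cell `pub-hfermat`): explicit algebraic cycles for specific Hodge classes on Fermat/Delsarte varieties; residual open
instances listed; no claim on general Hodge. These classes are algebraic (Lefschetz (1,1)); certified here is only the emptiness of the
exceptional list at this level.

## References
* [MeyerNeutsch1981Fermatquadrupel] W. Meyer, W. Neutsch, *Fermatquadrupel*, Math. Ann. 256 (1981) 51–62, §2 p. 53, Tabelle 1 p. 54 (no row 486).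
* [Shioda1982PicardFermat] T. Shioda, J. Fac. Sci. Univ. Tokyo IA 28 (1982) 725–734, table p. 727 (levels `≤ 180`), Prop. 4 (Q′) p. 729.
* [Aoki1983] N. Aoki, Math. Ann. 266 (1983) 23–54, Thm. C.
-/

namespace Literature.AlgebraicGeometry.Shioda1982

open Literature.AlgebraicGeometry.HodgeTheory

set_option maxHeartbeats 0 in
/-- **The search at `N = 486` passes on the first entries `0 ≤ a < 13`** (part 1 of 12: 13 chunks, 261678 candidate
triples): every visited sorted quadruple of representatives there fails the Hodge test or is standard (`checkB`; `reps 486 = []`).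
[cite: MeyerNeutsch1981Fermatquadrupel, §2 p. 53 ("alle Fermatquadrupel für N ≤ 614 ermittelt") and Tabelle 1 p. 54 (no row 486)]
[cite: Aoki1983, Thm. C] -/
theorem checkB_fourHundredEightySix_partOne :
    ∀ p ∈ ([(0, 1), (1, 1), (2, 1), (3, 1), (4, 1), (5, 1), (6, 1), (7, 1), (8, 1), (9, 1), (10, 1), (11, 1), (12, 1)] : List (ℕ × ℕ)), checkB 486 p.1 p.2 = true := by
  intro p hp
  simp only [List.mem_cons, List.not_mem_nil, or_false] at hp
  rcases hp with rfl | rfl | rfl | rfl | rfl | rfl | rfl | rfl | rfl | rfl | rfl | rfl | rfl <;> decide +kernel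

end Literature.AlgebraicGeometry.Shioda1982
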